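/-
Copyright: lit-balaban cell, Phase-2 proof seat p11 (gen 7; v1.1/v1.2 docstring corrections gen 8).  Statement-level skeleton of a
published paper; no proof claims beyond what the kernel checks below.
-/
import Literature.MathematicalPhysics.QuantumFieldTheory.BalabanImbrieJaffe1984to88.BIJ85TreeGaugeLineSums
import Literature.MathematicalPhysics.QuantumFieldTheory.BalabanImbrieJaffe1984to88.BIJ85Claim73AllTori
import Literature.MathematicalPhysics.QuantumFieldTheory.BalabanImbrieJaffe1984to88.BIJ85ResidualMinimizer
import Literature.MathematicalPhysics.QuantumFieldTheory.BalabanImbrieJaffe1984to88.BIJ85NoZeroModes309TorusPart2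

/-!
# `BalabanImbrieJaffe1984to88.BIJ85AxialLineSum` — T. Bałaban, J. Imbrie, A. Jaffe, *Renormalization of the Higgs model: minimizers,
propagators and the stability of mean field theory*, Commun. Math. Phys. **97** (1985) 299–329 [BalabanImbrieJaffe1985]: Sect. 7.3
p. 326 — **THE CENTRE-LINE AVERAGES OF THE AXIAL MINIMIZER `H_{k,Ax}B` REPRODUCE THE DATUM `B_b` UP TO `O(K_R·max|∂B|)`, UNIFORMLY IN
THE SCALE AND IN THE VOLUME** — the step *"we use (5.3.1) to replace this by a minimizer in axial gauge"* of the p. 326 mechanism for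
the second printed form of (7.3.2), made quantitative (file 2 of the gen-7 member of SKELETON row **C1.Eq7.3.1-7.3.2**; file 1 =
`BIJ85TreeGaugeLineSums` (the lattice-calculus engine), file 3 = `BIJ85LineSumCentre` (the identity for `T_k∂B` and the reduction of the
centre-line defect to Prop. 5.2.2's gauge function `D`)).

statement-level skeleton of published theorems with citation tags; proofs where landed; nothing here is a claim about the Yang–Mills mass gap

PDF held: `paper:balaban1985-cmp97-bij-higgs-minimizers` (journal page = PDF page + 298).  Pages re-read this session (OCR text):
p. 309–310 [PDF 11–12] ((4.1.1)–(4.1.5)), p. 313 [PDF 15] ((5.1.1)–(5.1.3)), p. 317 [PDF 19] ((5.3.1)), p. 326 [PDF 28].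

CITATION HEADER (lean-in-tree rule).  Phase-2 file of the lit-balaban TYPED SKELETON (HOME `run/shared/lean/pub/lit-balaban/`), seat p11
gen 7 (unit `lit-balaban-p11-g7`; TAKING line HOME/STATUS.md 2026-08-21T22:35:54Z; owner r15, referee ref-5).  Objects BY NAME, nothing
re-declared: p30/p11's `BIJ85Prop522Torus.HaxE` (`H_{k,Ax}` as an operator, (4.1.3)/(5.3.1)) and `HkE` (`H_k`, (4.4.2)), `ofLp_HaxE`,
`curlOp_comp_HaxE` ((5.2.8) `∂H_{k,Ax} = ∂H_k`); p33's `BIJ85NoZeroModes309TorusPart2.deltaAx_Hax_holds`/`bondAvgIter_Hax_holds` ((4.1.5):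
`δ_{k,Ax}(H_{k,Ax}B)`, `Q_kH_{k,Ax}B = B`, no hypothesis); p33's `BIJ85ResidualMinimizer.resE_dOne_eq_curlOp_HkE` (`f_k(∂B) = ∂H_kB`) with
`BIJ85Eq454PlaqResidual.resE` ((4.2.6)); p33/p30/p19's ALL-TORI residual constant `BIJ85Claim73AllTori.exists_KR_allTori` (one `K_R` over all
tori of a dimension and block size, hypothesis-free); file 1's `cline` (centre line sums along `B15DeterminingSets.embIter`) and
`abs_bondAvgIter_sub_cline_le'`.  Theorems only: no `def`/`abbrev`, no named fact (D-0026).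

THE PRINTED TEXT, verbatim (v1.1: re-read on the OCR layer `paper:balaban1985-cmp97-bij-higgs-minimizers` p0011/p0012/p0019/p0028
after referee ref-1's F4-nit of gen 47 — v1 had printed, inside the quotation marks, a PARAPHRASE of p. 310 and a GLOSS that is not on
p. 326; both are corrected here, nothing else in the file changes.  v1.2: ONE symbol of v1.1's p. 326 transcription corrected — the
operator in «we can substitute … in the formula for u_k» is print's script `𝒟_k∂^*` (the propagator (4.4.4), OCR glyph «3f_k»), which
v1.1 had mis-transcribed as «∂f_k∂^*»; the clause is the one recorded by the owner as GAPS G-C1-08 (sign slip vs (5.2.6), print-neutral).)  p. 309 l. −3 – p. 310 l. 7 [PDF 11–12]: *"Another aspect of the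
action S_G(A) = ½‖∂A‖² concerns what configurations minimize S_G(A) subject to the constraints of a gauge condition and a condition
that the average field Q_kA equals a given value B. We introduce a transformation H_{k,Ax} which maps B into such a minimizing
configuration for axial gauge, and we call H_{k,Ax} the axial gauge minimizer. Explicitly, (4.1.3) [display: the functional-integral
formula for H_{k,Ax}B, unreadable on the OCR layer — not transcribed] where Z_{k,Ax}(B) = ∫𝒟A δ(Q_kA − B)δ_{k,Ax}(A) exp(−½‖∂A‖²). (4.1.4)
Note that by definition Q_kH_{k,Ax}B = B. (4.1.5)"*; p. 317 [PDF 19] l. 21: *"H_{k,Ax}B = Q^{s*}_kB − G_{k,Ax}∂^*Q^{e*}_k∂B. (5.3.1)"*;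
p. 326 [PDF 28] l. 17–18 and l. 23–26: *"The second form of the inequality substitutes v_b for u_k(b) in the covariant derivative of φ. These inequalities can be
proved by an extension of the proofs of [7]."* … *"In axial gauge for the configuration v in a domain Λ′ ⊃ Λ we can substitute
𝒟_k∂^* = G_{k,Ax}∂^* + ∂D in the formula for u_k, we use (5.3.1) to replace this by a minimizer in axial gauge. Then we use (5.1.1) to
return the minimizers to Landau gauge."*  GLOSS (ours, NOT print; v1 had this sentence inside the p. 326 quotation): the hypothesis
(7.3.1) `|v(∂p) − 1| ≤ e_k𝓅(e_k)` on the unit lattice gives, for the smooth representative `u_k`, `|u_k(∂p) − 1| ≤ O(1)𝓅(e_k)e_kη²` on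
every η-lattice plaquette — this is p33's `BIJ85Claim73Closed.theta_of_hyp731_closed` (gen 7), a theorem of the skeleton, not a
sentence of the paper.

WHAT IS PROVED HERE (0 `sorry`, standard axioms; standing range, `2 ≤ d`).
* §1 the axial minimizer as a fine bond FUNCTION `ofLp (HaxE P (η^d) η⁻¹ k B) = H_{k,Ax}B` (weights of record `w = η^d`,
  `c = η⁻¹`; written out, no abbreviation is introduced): it lies in the iterated axial gauge and has block averages `B` (`deltaAx_hax`, `bondAvgIter_hax`, p33's
  theorems re-read), and ITS PLAQUETTE VARIABLE IS THE RESIDUAL FIELD: `curl 1 (H_{k,Ax}B)(p) = η·(√w)⁻¹·resE(∂B)(p)` (`curl_one_hax_eq`),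
  hence `|(H_{k,Ax}B)(∂p)| ≤ η·K_R·max|∂B|` from the kernel-shape residual bound (`abs_curl_one_hax_le`).
* §2 **`abs_sub_eta_cline_hax_le`** — one torus, one scale `1 ≤ k ≤ m + K`, GIVEN the residual bound with constant `K_R` on that torus:
  for every unit-lattice bond field `B` on `T^{(k)}` with `|(∂B)(q)| ≤ s` and every unit bond `b`,
  `|B_b − η·Σ_{b′ ⊂ centre line of b}(H_{k,Ax}B)(b′)| ≤ (d/2)·K_R·s` — file 1's multilevel tree-gauge lemma at `F = η·K_R·s`, the factor
  `L^k` against `η = L^{−k}`.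
* §3 **`exists_KH_allTori`** — HYPOTHESIS-FREE and UNIFORM: for every `d ≥ 2` and block size `L` there is ONE `K_H ≥ 0` such that for EVERY
  torus `P` with `P.d = d`, `P.L = L`, every scale `1 ≤ k ≤ m + K`, every `B` with `|∂B| ≤ s` and every unit bond `b`,
  `|B_b − η·cline_k(H_{k,Ax}B)(b)| ≤ K_H·s` (`K_H = (d/2)·K_R` with the all-tori `K_R` of `exists_KR_allTori`).
HONEST SCOPE.  (i) CENTRE lines (the representative sites `emb`/`embIter` of `Setup`'s centred blocks and the centre-rooted trees of p09's
`V411`), not the corner lines of gen 6's `lineSumIter` (print's corner convention (2.4), DIVERGENCE F3); the two line families differ by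
transversal connectors whose control is NOT claimed here (see GAPS G-C1-05 ADDENDUM 6).  (ii) This is the `K_H`-type half of the second printed
form along centre lines; the other half is the centre difference of Prop. 5.2.2's gauge function `D(Q^{e*}_k∂B)` (file 3).  (iii) `U = 1` real
abelian fields; torus; constants explicit, not optimised.  Nothing here is summit progress.
-/

open scoped BigOperators RealInnerProductSpace
open Finset

namespace Literature.MathematicalPhysics.QuantumFieldTheory.BalabanImbrieJaffe1984to88.BIJ85AxialLineSum

open Literature.MathematicalPhysics.QuantumFieldTheory.Balaban1983to89 hiding Site Plaq
open Balaban1983to89.LatticeFieldCalculus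
open BIJ85AxialPropagator411 (BondSpace PlaqSpace curlOp toE deltaAx)
open BIJ85AxialMinimizer413 (torusHax)
open BIJ85Eq531Inputs (QsstarIter)
open BIJ85Prop521Torus (CoarseSpace toEj)
open BIJ85Prop522Torus (HaxE HkE ofLp_HaxE curlOp_comp_HaxE)
open BIJ85Sigma421Torus (toU UnitPlaqSpace)
open BIJ85Sigma422Eta (eta_pos eta_inv)
open BIJ85Eq611Torus (dOne dOne_apply)
open BIJ85Eq454PlaqResidual (resE eta_mul_L_pow)
open BIJ85ResidualMinimizer (resE_dOne_eq_curlOp_HkE)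
open BIJ85NoZeroModes309TorusPart2 (deltaAx_Hax_holds bondAvgIter_Hax_holds)
open BIJ85UnitTorusHodge (IsClosedPlaq isClosedPlaq_curl)
open BIJ85Claim73AllTori (exists_KR_allTori)
open BIJ85TreeGaugeLineSums (cline abs_bondAvgIter_sub_cline_le')
open Balaban1983to89 renaming Site → TSite, Plaq → TPlaq

noncomputable section

variable {P : Params}

/-! ## §1  `H_{k,Ax}B` as a fine bond function: gauge, block averages, plaquette variable -/

/-- kernel: `η⁻¹ ≠ 0`. [cite: BalabanImbrieJaffe1985, (2.24) p.305] -/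
private theorem eta_inv_ne_zero (P : Params) (k : ℕ) : (P.eta k)⁻¹ ≠ 0 := inv_ne_zero (eta_pos P k).ne'

/-- kernel: `0 < η^d`. [cite: BalabanImbrieJaffe1985, (2.24) p.305] -/
private theorem eta_pow_pos (P : Params) (k : ℕ) : 0 < (P.eta k) ^ P.d := pow_pos (eta_pos P k) _

/-- **`δ_{k,Ax}(H_{k,Ax}B)`** — the axial minimizer lies in the iterated axial gauge (4.1.2) (p33's `deltaAx_Hax_holds`, no hypothesis).
[cite: BalabanImbrieJaffe1985, (4.1.5) p.310] -/
theorem deltaAx_hax {k : ℕ} (hk : k ≤ P.m + P.K) (B : CoarseSpace P k) : deltaAx k ((WithLp.ofLp (HaxE P ((P.eta k) ^ P.d) (P.eta k)⁻¹ k B))) := by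
  rw [ofLp_HaxE hk (eta_inv_ne_zero P k) (eta_pow_pos P k) B]
  exact deltaAx_Hax_holds hk (eta_pow_pos P k) (eta_inv_ne_zero P k) _

/-- **(4.1.5) `Q_kH_{k,Ax}B = B`** (p33's `bondAvgIter_Hax_holds`, no hypothesis). [cite: BalabanImbrieJaffe1985, (4.1.5) p.310] -/
theorem bondAvgIter_hax {k : ℕ} (hk : k ≤ P.m + P.K) (B : CoarseSpace P k) (b : PBond P k) :
    bondAvgIter k ((WithLp.ofLp (HaxE P ((P.eta k) ^ P.d) (P.eta k)⁻¹ k B))) b = B b := by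
  rw [ofLp_HaxE hk (eta_inv_ne_zero P k) (eta_pow_pos P k) B, bondAvgIter_Hax_holds hk (eta_pow_pos P k) (eta_inv_ne_zero P k)]

/-- kernel: the plaquette variable with lattice factor `c` is `c` times the plain circulation. [cite: Balaban1984PropagatorsI, (1.2) p.18] -/
theorem curl_eq_mul_curl_one {j : ℕ} (c : ℝ) (A : VecField P j ℝ) (p : TPlaq P j) : curl c A p = c * curl 1 A p := by
  simp only [curl, smul_eq_mul, one_mul]

/-- kernel: p09's weighted curl componentwise, `(curlOp w c v)(p) = √w·c·(ofLp v)(∂p)`. [cite: BalabanImbrieJaffe1985, (4.1.1) p.309] -/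
theorem curlOp_apply_eq (w c : ℝ) (v : BondSpace P) (p : TPlaq P 0) :
    curlOp (P := P) w c v p = Real.sqrt w * (c * curl 1 (WithLp.ofLp v) p) := by
  rw [← curl_eq_mul_curl_one]
  rfl

/-- **THE PLAQUETTE VARIABLE OF `H_{k,Ax}B` IS THE RESIDUAL FIELD**: `(H_{k,Ax}B)(∂p) = η·(√(η^d))⁻¹·resE(∂B)(p)` — (5.2.8) `∂H_{k,Ax} = ∂H_k`
(`curlOp_comp_HaxE`) and `f_k(∂B) = ∂H_kB` (p33's `resE_dOne_eq_curlOp_HkE`), the weights unfolded (`2 ≤ d`, `k ≤ m + K`).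
[cite: BalabanImbrieJaffe1985, (5.2.8) p.316] -/
theorem curl_one_hax_eq (hd : 2 ≤ P.d) {k : ℕ} (hk : k ≤ P.m + P.K) (B : CoarseSpace P k) (p : TPlaq P 0) :
    curl 1 ((WithLp.ofLp (HaxE P ((P.eta k) ^ P.d) (P.eta k)⁻¹ k B))) p =
      P.eta k * ((Real.sqrt ((P.eta k) ^ P.d))⁻¹ * resE hd ((P.eta k) ^ P.d) (P.eta k)⁻¹ k (dOne P k (P.eta k)⁻¹ B) p) := by
  have hs : Real.sqrt ((P.eta k) ^ P.d) ≠ 0 := (Real.sqrt_pos.2 (eta_pow_pos P k)).ne'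
  have hη : P.eta k ≠ 0 := (eta_pos P k).ne'
  have h1 : curlOp (P := P) ((P.eta k) ^ P.d) (P.eta k)⁻¹ (HaxE P ((P.eta k) ^ P.d) (P.eta k)⁻¹ k B)
      = curlOp (P := P) ((P.eta k) ^ P.d) (P.eta k)⁻¹ (HkE P ((P.eta k) ^ P.d) (P.eta k)⁻¹ k B) := by
    simpa only [LinearMap.comp_apply] using
      LinearMap.congr_fun (curlOp_comp_HaxE hk (eta_inv_ne_zero P k) (eta_pow_pos P k)) B
  have h2 : resE hd ((P.eta k) ^ P.d) (P.eta k)⁻¹ k (dOne P k (P.eta k)⁻¹ B) p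
      = Real.sqrt ((P.eta k) ^ P.d) * ((P.eta k)⁻¹ * curl 1 ((WithLp.ofLp (HaxE P ((P.eta k) ^ P.d) (P.eta k)⁻¹ k B))) p) := by
    rw [resE_dOne_eq_curlOp_HkE hd hk (eta_inv_ne_zero P k) (eta_pow_pos P k), ← h1, curlOp_apply_eq]
  rw [h2, ← mul_assoc (Real.sqrt ((P.eta k) ^ P.d))⁻¹, inv_mul_cancel₀ hs, one_mul, ← mul_assoc, mul_inv_cancel₀ hη, one_mul]

/-- **`|(H_{k,Ax}B)(∂p)| ≤ η·K_R·s` on every fine plaquette**, from the kernel-shape residual bound `|resE(∂B)| ≤ K_R√(η^d)·s` for the CLOSED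
unit field `∂B` (here a hypothesis `hR` with constant `KR`; `|(∂B)(q)| ≤ s`; the unit curl `dOne` at `c = η⁻¹` has factor `η⁻¹/L^k = 1`).
[cite: BalabanImbrieJaffe1985, (7.2.2) p.325] -/
theorem abs_curl_one_hax_le (hd : 2 ≤ P.d) {k : ℕ} (hk : k ≤ P.m + P.K) {KR : ℝ}
    (hR : ∀ (f : TPlaq P k → ℝ), IsClosedPlaq f → ∀ (s : ℝ), 0 ≤ s → (∀ q, |f q| ≤ s) →
      ∀ p : TPlaq P 0, |resE hd ((P.eta k) ^ P.d) (P.eta k)⁻¹ k (toU P k f) p| ≤ KR * Real.sqrt ((P.eta k) ^ P.d) * s)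
    (B : CoarseSpace P k) {s : ℝ} (hs0 : 0 ≤ s) (hs : ∀ q, |curl 1 (WithLp.ofLp B) q| ≤ s) (p : TPlaq P 0) :
    |curl 1 ((WithLp.ofLp (HaxE P ((P.eta k) ^ P.d) (P.eta k)⁻¹ k B))) p| ≤ P.eta k * KR * s := by
  have hsq : 0 < Real.sqrt ((P.eta k) ^ P.d) := Real.sqrt_pos.2 (eta_pow_pos P k)
  have hη : 0 < P.eta k := eta_pos P k
  -- the unit curl of record at `c = η⁻¹` is the plain circulation (factor `η⁻¹/L^k = 1`)
  have hfac : (P.eta k)⁻¹ / (P.L : ℝ) ^ k = 1 := by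
    rw [eta_inv, div_self (pow_ne_zero _ (Nat.cast_ne_zero.mpr P.L_pos.ne'))]
  have hf : (fun q => dOne P k (P.eta k)⁻¹ B q) = curl 1 (WithLp.ofLp B) := by
    funext q; rw [dOne_apply, hfac]
  have hclosed : IsClosedPlaq (fun q => dOne P k (P.eta k)⁻¹ B q) := by rw [hf]; exact isClosedPlaq_curl 1 _
  have hs' : ∀ q, |(fun q => dOne P k (P.eta k)⁻¹ B q) q| ≤ s := fun q => by rw [hf]; exact hs q
  have htoU : toU P k (fun q => dOne P k (P.eta k)⁻¹ B q) = dOne P k (P.eta k)⁻¹ B := rfl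
  have h := hR _ hclosed s hs0 hs' p
  rw [htoU] at h
  rw [curl_one_hax_eq hd hk B p, abs_mul, abs_mul, abs_of_pos hη, abs_inv, abs_of_pos hsq]
  calc P.eta k * ((Real.sqrt ((P.eta k) ^ P.d))⁻¹ * |resE hd ((P.eta k) ^ P.d) (P.eta k)⁻¹ k (dOne P k (P.eta k)⁻¹ B) p|)
      ≤ P.eta k * ((Real.sqrt ((P.eta k) ^ P.d))⁻¹ * (KR * Real.sqrt ((P.eta k) ^ P.d) * s)) :=
        mul_le_mul_of_nonneg_left (mul_le_mul_of_nonneg_left h (by positivity)) hη.le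
    _ = P.eta k * KR * s := by field_simp

/-! ## §2  One torus: the centre-line averages of `H_{k,Ax}B` against the datum -/

/-- **`|B_b − η·cline_k(H_{k,Ax}B)(b)| ≤ (d/2)·K_R·s`** — one torus `P`, one scale `k ≤ m + K`, GIVEN the residual bound with constant
`K_R` on `P` at scale `k`: for every unit-lattice bond field `B` with `|(∂B)(q)| ≤ s` and every unit bond `b`, the straight fine line from
the iterated centre `embIter_k(b₋)` (file 1's `cline`) of the axial minimizer averages to `B_b` up to `(d/2)·K_R·s` — file 1's
`abs_bondAvgIter_sub_cline_le'` at `F = η·K_R·s` with (4.1.5), `η·L^k = 1`. [cite: BalabanImbrieJaffe1985, (7.3.2) p.326] -/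
theorem abs_sub_eta_cline_hax_le (hd : 2 ≤ P.d) {k : ℕ} (hk : k ≤ P.m + P.K) {KR : ℝ}
    (hR : ∀ (f : TPlaq P k → ℝ), IsClosedPlaq f → ∀ (s : ℝ), 0 ≤ s → (∀ q, |f q| ≤ s) →
      ∀ p : TPlaq P 0, |resE hd ((P.eta k) ^ P.d) (P.eta k)⁻¹ k (toU P k f) p| ≤ KR * Real.sqrt ((P.eta k) ^ P.d) * s)
    (hKR : 0 ≤ KR) (B : CoarseSpace P k) {s : ℝ} (hs0 : 0 ≤ s) (hs : ∀ q, |curl 1 (WithLp.ofLp B) q| ≤ s) (b : PBond P k) :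
    |B b - P.eta k * cline k ((WithLp.ofLp (HaxE P ((P.eta k) ^ P.d) (P.eta k)⁻¹ k B))) b| ≤ (P.d : ℝ) / 2 * KR * s := by
  have hη : 0 < P.eta k := eta_pos P k
  have hF0 : 0 ≤ P.eta k * KR * s := by positivity
  have h := abs_bondAvgIter_sub_cline_le' hk (deltaAx_hax hk B) hF0 (abs_curl_one_hax_le hd hk hR B hs0 hs) b
  rw [bondAvgIter_hax hk B b, ← eta_inv, inv_inv] at h
  calc |B b - P.eta k * cline k ((WithLp.ofLp (HaxE P ((P.eta k) ^ P.d) (P.eta k)⁻¹ k B))) b| ≤ (P.d : ℝ) / 2 * (P.eta k)⁻¹ * (P.eta k * KR * s) := h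
    _ = (P.d : ℝ) / 2 * KR * s := by field_simp

/-! ## §3  All tori: one constant, no hypothesis -/

/-- **ONE `K_H` FOR ALL TORI, HYPOTHESIS-FREE**: for every dimension `d ≥ 2` and block size `L` there is `K_H ≥ 0` such that for EVERY torus
`P` of the series with `P.d = d`, `P.L = L`, every scale `1 ≤ k ≤ m + K`, every unit-lattice bond field `B` on `T^{(k)}` with `|(∂B)(q)| ≤ s`
(`s ≥ 0`) and every unit bond `b`: `|B_b − η·cline_k(H_{k,Ax}B)(b)| ≤ K_H·s` — `K_H = (d/2)·K_R` with the all-tori residual constant of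
p33/p30/p19 (`BIJ85Claim73AllTori.exists_KR_allTori`, [6I] Prop. 1.2 over all tori by its tree name inside).  The `K_H`-half of the located
line-sum constant of the second printed form of (7.3.2), along CENTRE lines, uniformly in the scale and in the volume.
[cite: BalabanImbrieJaffe1985, (7.3.2) p.326] -/
theorem exists_KH_allTori {d L : ℕ} (hd : 2 ≤ d) :
    ∃ KH : ℝ, 0 ≤ KH ∧ ∀ (P : Params) (hPd : P.d = d), P.L = L → ∀ (k : ℕ), 1 ≤ k → k ≤ P.m + P.K →
      ∀ (B : CoarseSpace P k) (s : ℝ), 0 ≤ s → (∀ q, |curl 1 (WithLp.ofLp B) q| ≤ s) → ∀ b : PBond P k,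
        |B b - P.eta k * cline k ((WithLp.ofLp (HaxE P ((P.eta k) ^ P.d) (P.eta k)⁻¹ k B))) b| ≤ KH * s := by
  obtain ⟨KR, hKR1, hKR⟩ := exists_KR_allTori (L := L) hd (a := 1) one_pos
  refine ⟨(d : ℝ) / 2 * KR, by positivity, fun P hPd hPL k hk1 hk B s hs0 hs b => ?_⟩
  have h := abs_sub_eta_cline_hax_le (hd.trans_eq hPd.symm) hk (hKR P hPd hPL k hk1 hk) (by linarith) B hs0 hs b
  have hcast : (P.d : ℝ) = d := by exact_mod_cast hPd
  rw [hcast] at h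
  exact h

end

end Literature.MathematicalPhysics.QuantumFieldTheory.BalabanImbrieJaffe1984to88.BIJ85AxialLineSum
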